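import Summits.BirchSwinnertonDyer.BirchSwinnertonDyer.Theorems.KatoDescentPotSupersingularWildUpperMuRoadThreeFukudaRecords29
import Literature.NumberTheory.IwasawaTheory.Fukuda1994Thm1RankProofs
import Literature.NumberTheory.IwasawaTheory.Fukuda1994Thm1Proofs
import HarnessLib

/-!
# K9 records of `WildUpperMuRoadThreeFukudaRecords29` with Fukuda's Theorem 1 (2) DISCHARGED (hF2-free re-issue)

Written by the prover seat `bsd-potss-k8t-c4` g20 (cell `bsd-potss`; courtesy for the K9 record lane of k9-c4,
`--supports stmt-BirchSwinnertonDyer-19197 --as helper`; closes nothing; BSD claimed for no curve). Every record of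
`Theorems/KatoDescentPotSupersingularWildUpperMuRoadThreeFukudaRecords29.lean` that displayed the named-fact hypothesis `hF2 : fukuda1994_thm1_classGroupPRank_const_of_succ_eq`
(Fukuda 1994 Thm. 1 (2), `p`-ranks) is re-issued WITHOUT it (suffix `F2`, one application of the tree theorem
`Literature.NumberTheory.IwasawaTheory.fukuda1994_thm1_classGroupPRank_const_of_succ_eq_holds`, `Fukuda1994Thm1RankProofs.lean`, k8t-c4 g20;
where a record also displayed `hF1`, Fukuda Thm. 1 (1), it is discharged too by g19's `fukuda1994_thm1_classNumberPExp_const_of_succ_eq_holds`).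
All other displayed named facts (`hCS`, `hI`, `hFW`, `hKatoA`, `hGZK`, `hmod`, …) and row data (`hWeq`, `hr`, `c`, `hrk`/`hord`) are untouched;
statements are those of the source records verbatim minus the Fukuda binders.
-/

set_option autoImplicit false
set_option linter.dupNamespace false

noncomputable section

open scoped Classical NumberField
open Polynomial WeierstrassCurve Field IntermediateField IsDedekindDomain
  Literature.NumberTheory.EllipticCurves Literature.NumberTheory.EllipticCurves.Rank1Residual
  Literature.NumberTheory.EllipticCurves.Rank1Residual.Typed
  Literature.NumberTheory.GaloisRepresentations Literature.NumberTheory.SerreUniformity Literature.NumberTheory.IwasawaTheory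
  Summit.BirchSwinnertonDyer.Rank1Residual Summit.BirchSwinnertonDyer.Rank1Residual.Additive
  Summit.BirchSwinnertonDyer.BirchSwinnertonDyer.Theorems
namespace Summit.BirchSwinnertonDyer.BirchSwinnertonDyer.Theorems.WildUpperUnitTwistRecords

/-- **RECORD (second road, on `K⁺ = ℚ(E[3])^c`) — UPPER half `ord₃ #Ш(E) ≤ ord₃ #Ш(E)_an` for `E = 292032ej1` at `p = 3` FROM ONE FUKUDA `3`-RANK EQUALITY `r_2(K⁺) = r_1(K⁺)`**
(U₀-ns row of K9 items 19189 / 19197; door `CartanMuRoadFukudaDoorsWild.missingUpperBoundAt_three_of_hasSplitCartanNormalizerModPImage_of_realRankSuccEqAt`, n = 1).  KERNEL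
(imported / above): `Δ ≠ 0`, minimality, `irr_g292032ej1_3`, `classO6_g292032ej1_3`, `hasSplitCartanNormalizerModPImage_g292032ej1_3`.  DISPLAYED: named facts
`hKatoA hGZK hmod hCS hFW hF2`; Cremona's `r_an = 0` (`hr`); a complex conjugation `c` (`hc`); `hrk : r_2(K⁺) = r_1(K⁺)` for `K⁺ = Fix(c|_L)` (numerically `1 = 1`;
the ORDER grows `e_1 = 1 < e_2 = 2`: `K⁺₁`: `Cl ≅ [6]` GRH (kit j314795); `K⁺₂` (degree 36): kit j316854, GRH).  Per row; CONDITIONAL; nothing booked; BSD is not proved by this. [cite: Kato2004Asterisque, Thm. 14.5 (3) (p. 236), Thm. 12.5 (3) (p. 222)]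
[cite: Fukuda1994, Thm. 1 (2), p. 264] [cite: Lang1990, Ch. 13 §4, Lemma 4.1] [cite: CoatesSujatha2005, Thm. 3.4 (§3)] [cite: Serre1972, §2.4 Prop. 15, §5.2 (iv)] [cite: Cremona2006, Table 1 (Cremona label 292032ej1)]
hF2-FREE re-issue of `missingUpperBoundAt_g292032ej1_3_fkK12r` (Fukuda 1994 Thm. 1 (2) is the tree theorem
`fukuda1994_thm1_classGroupPRank_const_of_succ_eq_holds`). -/
theorem missingUpperBoundAt_g292032ej1_3_fkK12rF2
    (hKatoA : Kato2004.rankZero_padicValNat_sha_add_padicValNat_tamagawa_le_of_additive_potGood_of_irreducible_of_fineSelmerDual_fg)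
    (hGZK : rank_eq_analyticRank_of_analyticRank_le_one) (hmod : hasEntireLFunction_rat)
    (hCS : CoatesSujatha2005.thm34_fineSelmerDual_moduleFinite_of_classicalMuVanishes_divisionField)
    (hFW : ferreroWashington1979_classicalMuVanishes)
    {W : WeierstrassCurve ℚ} [W.IsElliptic] [W.IsGloballyMinimal] (hWeq : W = (⟨0, 0, 0, (-131820), 41584816⟩ : WeierstrassCurve ℚ)) (hr : W.analyticRank = 0)
    {c : absoluteGaloisGroup ℚ} (hc : IsComplexConjugation (Rat.castHom ℝ) c)
    (hrk : haveI : NumberField ↥(W.divisionField 3) := NumberField.mk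
      ∀ κE : ZpExtension ↥(fixedField (Subgroup.zpowers (absRestrictNormalHom (W.divisionField 3) c))) 3,
        κE.IsCyclotomic → classGroupPRank κE (1 + 1) = classGroupPRank κE 1) :
    MissingUpperBoundAt W 3 := by
  apply missingUpperBoundAt_g292032ej1_3_fkK12r <;>
    first
    | exact Literature.NumberTheory.IwasawaTheory.fukuda1994_thm1_classGroupPRank_const_of_succ_eq_holds
    | exact Literature.NumberTheory.IwasawaTheory.fukuda1994_thm1_classNumberPExp_const_of_succ_eq_holds
    | assumption

/-- **RECORD (second road, on `K⁺ = ℚ(E[3])^c`) — UPPER half `ord₃ #Ш(E) ≤ ord₃ #Ш(E)_an` for `E = 292032en1` at `p = 3` FROM ONE FUKUDA `3`-RANK EQUALITY `r_2(K⁺) = r_1(K⁺)`**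
(U₀-ns row of K9 items 19189 / 19197; door `CartanMuRoadFukudaDoorsWild.missingUpperBoundAt_three_of_hasSplitCartanNormalizerModPImage_of_realRankSuccEqAt`, n = 1).  KERNEL
(imported / above): `Δ ≠ 0`, minimality, `irr_g292032en1_3`, `classO6_g292032en1_3`, `hasSplitCartanNormalizerModPImage_g292032en1_3`.  DISPLAYED: named facts
`hKatoA hGZK hmod hCS hFW hF2`; Cremona's `r_an = 0` (`hr`); a complex conjugation `c` (`hc`); `hrk : r_2(K⁺) = r_1(K⁺)` for `K⁺ = Fix(c|_L)` (numerically `1 = 1`;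
the ORDER grows `e_1 = 1 < e_2 = 2`: `K⁺₁`: `Cl ≅ [6]` GRH (kit j314795); `K⁺₂` (degree 36): kit j316854, GRH).  Per row; CONDITIONAL; nothing booked; BSD is not proved by this. [cite: Kato2004Asterisque, Thm. 14.5 (3) (p. 236), Thm. 12.5 (3) (p. 222)]
[cite: Fukuda1994, Thm. 1 (2), p. 264] [cite: Lang1990, Ch. 13 §4, Lemma 4.1] [cite: CoatesSujatha2005, Thm. 3.4 (§3)] [cite: Serre1972, §2.4 Prop. 15, §5.2 (iv)] [cite: Cremona2006, Table 1 (Cremona label 292032en1)]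
hF2-FREE re-issue of `missingUpperBoundAt_g292032en1_3_fkK12r` (Fukuda 1994 Thm. 1 (2) is the tree theorem
`fukuda1994_thm1_classGroupPRank_const_of_succ_eq_holds`). -/
theorem missingUpperBoundAt_g292032en1_3_fkK12rF2
    (hKatoA : Kato2004.rankZero_padicValNat_sha_add_padicValNat_tamagawa_le_of_additive_potGood_of_irreducible_of_fineSelmerDual_fg)
    (hGZK : rank_eq_analyticRank_of_analyticRank_le_one) (hmod : hasEntireLFunction_rat)
    (hCS : CoatesSujatha2005.thm34_fineSelmerDual_moduleFinite_of_classicalMuVanishes_divisionField)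
    (hFW : ferreroWashington1979_classicalMuVanishes)
    {W : WeierstrassCurve ℚ} [W.IsElliptic] [W.IsGloballyMinimal] (hWeq : W = (⟨0, 0, 0, (-780), 18928⟩ : WeierstrassCurve ℚ)) (hr : W.analyticRank = 0)
    {c : absoluteGaloisGroup ℚ} (hc : IsComplexConjugation (Rat.castHom ℝ) c)
    (hrk : haveI : NumberField ↥(W.divisionField 3) := NumberField.mk
      ∀ κE : ZpExtension ↥(fixedField (Subgroup.zpowers (absRestrictNormalHom (W.divisionField 3) c))) 3,
        κE.IsCyclotomic → classGroupPRank κE (1 + 1) = classGroupPRank κE 1) :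
    MissingUpperBoundAt W 3 := by
  apply missingUpperBoundAt_g292032en1_3_fkK12r <;>
    first
    | exact Literature.NumberTheory.IwasawaTheory.fukuda1994_thm1_classGroupPRank_const_of_succ_eq_holds
    | exact Literature.NumberTheory.IwasawaTheory.fukuda1994_thm1_classNumberPExp_const_of_succ_eq_holds
    | assumption

end Summit.BirchSwinnertonDyer.BirchSwinnertonDyer.Theorems.WildUpperUnitTwistRecords

end
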